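import Mathlib
import HarnessLib

/-!
# Domination by measure-preserving translates: the abstract step of the «paired covariant sheet translates» argument

Support module for the translate cruxes of seat ym-idea-4's LINE g12-A/B (`ToronSmallBall.ToronCoreRaritySubQuartic` ⟨stmt-QuantumFields-23956⟩ stubs
`stub_domination_fat/small`, `OffCoreStripWindowDeep` ⟨23957⟩, `QuantileBitPurity.HolonomyQuantileSubQuartic` ⟨23948⟩, `HolonomyLevyWindowDeep` ⟨23949⟩;
memos HOME `bc/g12-A/PLAN-X1-v2-gauss.md` §2–§3, `bc/g12-dw/PLAN-SB.md` B4).  PURE MEASURE THEORY, no lattice object: the pattern «a pair of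
measure-preserving maps `T₊, T₋` (the `±kδ` translates) sends the event `A` (core ∩ good) into the event `B` (the `k`-th annulus) and the weight `F` (the
chain density) satisfies `2F ≤ C (F∘T₊ + F∘T₋)` on `A` (the ± pairing kills the odd part of the cost: `e^{−ℓ−q} + e^{ℓ−q'} ≥ 2e^{−Q}`), hence
`∫_A F ≤ C ∫_B F`»:

* ★ `setIntegral_le_of_paired_maps` — the paired domination inequality (and the one-map version `setIntegral_le_of_map`);
* `two_mul_exp_neg_le_add` — `2e^{−Q} ≤ e^{−ℓ−q} + e^{ℓ−q'}` for `q, q' ≤ Q` (the even-cost bookkeeping of the ± pairing);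
* `mul_setIntegral_le_of_disjoint` — with `K` maps into pairwise disjoint events, `K · ∫_A F ≤ C · ∫ F` (translate counting, PLAN-SB B4).

HONEST FRAMING: abstract bookkeeping for doors/cruxes of DRAFT lines onto RECORD rungs; nothing about lattice gauge theory is proved here.  No `sorry`, no new
axiom, no new definition.  References: [cite: MadrasSokal1988, §2]; [cite: Luscher1983, §2].
-/

set_option autoImplicit false

noncomputable section

open MeasureTheory Set
open scoped BigOperators

namespace Summit.QuantumFields.YangMills.Theorems.FemtoTransferGap.Translate

variable {X : Type*} [MeasurableSpace X] {μ : Measure X}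

/-- Transport of a restricted weight along a measure-preserving map: `∫_{T⁻¹B} F∘T dμ = ∫_B F dμ` for integrable `F`. [folklore] -/
theorem setIntegral_preimage_comp_eq {T : X → X} (hT : MeasurePreserving T μ μ) {F : X → ℝ} (hFi : Integrable F μ) {B : Set X}
    (hB : MeasurableSet B) : ∫ x in T ⁻¹' B, F (T x) ∂μ = ∫ x in B, F x ∂μ := by
  rw [← integral_indicator (hT.measurable hB), ← integral_indicator hB]
  have e1 : (fun x => (T ⁻¹' B).indicator (fun x => F (T x)) x) = fun x => (B.indicator F) (T x) := by
    funext x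
    exact Set.indicator_comp_right T
  rw [e1]
  have hae : AEStronglyMeasurable (B.indicator F) (Measure.map T μ) := by
    rw [hT.map_eq]; exact (hFi.indicator hB).aestronglyMeasurable
  rw [← integral_map hT.measurable.aemeasurable hae, hT.map_eq]

/-- **Domination by one measure-preserving map**: if `T` preserves `μ`, sends `A` into `B`, and `F ≤ C · F∘T` on `A` (`F ≥ 0` integrable, `C ≥ 0`), then
`∫_A F ≤ C ∫_B F`. [folklore] -/
theorem setIntegral_le_of_map {T : X → X} (hT : MeasurePreserving T μ μ) {F : X → ℝ} (hF0 : ∀ x, 0 ≤ F x) (hFi : Integrable F μ)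
    {A B : Set X} (hA : MeasurableSet A) (hB : MeasurableSet B) (hAB : A ⊆ T ⁻¹' B) {C : ℝ} (hC : 0 ≤ C)
    (hdom : ∀ x ∈ A, F x ≤ C * F (T x)) :
    ∫ x in A, F x ∂μ ≤ C * ∫ x in B, F x ∂μ := by
  have hFT : Integrable (fun x => F (T x)) μ := (hT.integrable_comp hFi.aestronglyMeasurable).mpr hFi |> fun h => by
    simpa only [Function.comp_def] using h
  calc ∫ x in A, F x ∂μ ≤ ∫ x in A, C * F (T x) ∂μ :=
        setIntegral_mono_on hFi.integrableOn (hFT.const_mul C).integrableOn hA hdom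
    _ = C * ∫ x in A, F (T x) ∂μ := integral_const_mul _ _
    _ ≤ C * ∫ x in T ⁻¹' B, F (T x) ∂μ := by
        refine mul_le_mul_of_nonneg_left ?_ hC
        exact setIntegral_mono_set hFT.integrableOn (Filter.Eventually.of_forall fun x => hF0 _) (Filter.Eventually.of_forall hAB)
    _ = C * ∫ x in B, F x ∂μ := by rw [setIntegral_preimage_comp_eq hT hFi hB]

/-- ★ **Domination by a PAIR of measure-preserving maps** (the ± translates): if `T₊, T₋` preserve `μ`, both send `A` into `B`, and `2F ≤ C (F∘T₊ + F∘T₋)` on `A`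
(`F ≥ 0` integrable, `C ≥ 0`), then `∫_A F ≤ C ∫_B F`. [cite: Luscher1983, §2] -/
theorem setIntegral_le_of_paired_maps {Tp Tm : X → X} (hTp : MeasurePreserving Tp μ μ) (hTm : MeasurePreserving Tm μ μ) {F : X → ℝ}
    (hF0 : ∀ x, 0 ≤ F x) (hFi : Integrable F μ) {A B : Set X} (hA : MeasurableSet A) (hB : MeasurableSet B) (hAp : A ⊆ Tp ⁻¹' B)
    (hAm : A ⊆ Tm ⁻¹' B) {C : ℝ} (hC : 0 ≤ C) (hdom : ∀ x ∈ A, 2 * F x ≤ C * (F (Tp x) + F (Tm x))) :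
    ∫ x in A, F x ∂μ ≤ C * ∫ x in B, F x ∂μ := by
  have hint : ∀ {T : X → X}, MeasurePreserving T μ μ → Integrable (fun x => F (T x)) μ := fun {T} hT => by
    have h := (hT.integrable_comp hFi.aestronglyMeasurable).mpr hFi
    simpa only [Function.comp_def] using h
  have hFp := hint hTp
  have hFm := hint hTm
  have hbd : ∀ {T : X → X}, MeasurePreserving T μ μ → A ⊆ T ⁻¹' B → ∫ x in A, F (T x) ∂μ ≤ ∫ x in B, F x ∂μ := fun {T} hT hAT => by
    calc ∫ x in A, F (T x) ∂μ ≤ ∫ x in T ⁻¹' B, F (T x) ∂μ :=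
          setIntegral_mono_set (hint hT).integrableOn (Filter.Eventually.of_forall fun x => hF0 _) (Filter.Eventually.of_forall hAT)
      _ = ∫ x in B, F x ∂μ := setIntegral_preimage_comp_eq hT hFi hB
  have h1 : ∫ x in A, 2 * F x ∂μ ≤ ∫ x in A, C * (F (Tp x) + F (Tm x)) ∂μ :=
    setIntegral_mono_on (hFi.const_mul 2).integrableOn ((hFp.add hFm).const_mul C).integrableOn hA hdom
  rw [integral_const_mul, integral_const_mul, integral_add hFp.integrableOn hFm.integrableOn] at h1
  have h2 := hbd hTp hAp
  have h3 := hbd hTm hAm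
  nlinarith [h1, h2, h3, hC]

/-- **The ± pairing kills the odd part of the cost**: for `q, q' ≤ Q` and any `ℓ`, `2e^{−Q} ≤ e^{−ℓ−q} + e^{ℓ−q'}` (`e^{ℓ} + e^{−ℓ} ≥ 2`). [folklore] -/
theorem two_mul_exp_neg_le_add {ℓ q q' Q : ℝ} (hq : q ≤ Q) (hq' : q' ≤ Q) :
    2 * Real.exp (-Q) ≤ Real.exp (-ℓ - q) + Real.exp (ℓ - q') := by
  have h1 : Real.exp (-ℓ - Q) ≤ Real.exp (-ℓ - q) := Real.exp_le_exp.mpr (by linarith)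
  have h2 : Real.exp (ℓ - Q) ≤ Real.exp (ℓ - q') := Real.exp_le_exp.mpr (by linarith)
  have hcosh : 2 ≤ Real.exp ℓ + Real.exp (-ℓ) := by
    have h := Real.one_le_cosh ℓ
    rw [Real.cosh_eq] at h
    linarith
  have e1 : Real.exp (-ℓ - Q) = Real.exp (-Q) * Real.exp (-ℓ) := by rw [← Real.exp_add]; congr 1; ring
  have e2 : Real.exp (ℓ - Q) = Real.exp (-Q) * Real.exp ℓ := by rw [← Real.exp_add]; congr 1; ring
  have h3 : 2 * Real.exp (-Q) ≤ Real.exp (-ℓ - Q) + Real.exp (ℓ - Q) := by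
    rw [e1, e2]; nlinarith [Real.exp_pos (-Q), hcosh]
  linarith

/-- The pointwise form used with `setIntegral_le_of_paired_maps`: if `F(T₊x) = e^{−ℓ−q} F(x)` and `F(T₋x) = e^{ℓ−q'} F(x)` with `q, q' ≤ Q` and `F(x) ≥ 0`, then
`2 F(x) ≤ e^{Q} (F(T₊x) + F(T₋x))`. [folklore] -/
theorem two_mul_le_exp_mul_add {Fx Fp Fm ℓ q q' Q : ℝ} (hF : 0 ≤ Fx) (hp : Fp = Real.exp (-ℓ - q) * Fx) (hm : Fm = Real.exp (ℓ - q') * Fx)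
    (hq : q ≤ Q) (hq' : q' ≤ Q) : 2 * Fx ≤ Real.exp Q * (Fp + Fm) := by
  rw [hp, hm, ← add_mul, ← mul_assoc]
  have h := two_mul_exp_neg_le_add (ℓ := ℓ) hq hq'
  have h2 : 2 ≤ Real.exp Q * (Real.exp (-ℓ - q) + Real.exp (ℓ - q')) := by
    have e : Real.exp Q * (2 * Real.exp (-Q)) = 2 := by
      rw [mul_comm, mul_assoc, ← Real.exp_add, neg_add_cancel, Real.exp_zero, mul_one]
    calc (2 : ℝ) = Real.exp Q * (2 * Real.exp (-Q)) := e.symm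
      _ ≤ Real.exp Q * (Real.exp (-ℓ - q) + Real.exp (ℓ - q')) := mul_le_mul_of_nonneg_left h (Real.exp_pos Q).le
  nlinarith [h2, hF]

/-- **Translate counting** (PLAN-SB B4): if for each `k < K` a measure-preserving argument gives `∫_A F ≤ C ∫_{B k} F` and the events `B k` are pairwise disjoint
and measurable (`F ≥ 0` integrable), then `K · ∫_A F ≤ C · ∫ F`. [cite: MadrasSokal1988, §2] -/
theorem mul_setIntegral_le_of_disjoint {F : X → ℝ} (hF0 : ∀ x, 0 ≤ F x) (hFi : Integrable F μ) {A : Set X} {K : ℕ} {B : ℕ → Set X}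
    (hB : ∀ k, MeasurableSet (B k)) (hdisj : Pairwise (Function.onFun Disjoint B)) {C : ℝ} (hC : 0 ≤ C)
    (hdom : ∀ k, k < K → ∫ x in A, F x ∂μ ≤ C * ∫ x in B k, F x ∂μ) :
    (K : ℝ) * ∫ x in A, F x ∂μ ≤ C * ∫ x, F x ∂μ := by
  have hsum : (K : ℝ) * ∫ x in A, F x ∂μ ≤ C * ∑ k ∈ Finset.range K, ∫ x in B k, F x ∂μ := by
    calc (K : ℝ) * ∫ x in A, F x ∂μ = ∑ k ∈ Finset.range K, ∫ x in A, F x ∂μ := by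
          rw [Finset.sum_const, Finset.card_range, nsmul_eq_mul]
      _ ≤ ∑ k ∈ Finset.range K, C * ∫ x in B k, F x ∂μ := Finset.sum_le_sum fun k hk => hdom k (Finset.mem_range.mp hk)
      _ = C * ∑ k ∈ Finset.range K, ∫ x in B k, F x ∂μ := by rw [Finset.mul_sum]
  refine hsum.trans (mul_le_mul_of_nonneg_left ?_ hC)
  -- `Σ_k ∫_{B k} F = ∫_{⋃ B k} F ≤ ∫ F`
  have hU : ∑ k ∈ Finset.range K, ∫ x in B k, F x ∂μ = ∫ x in ⋃ k ∈ Finset.range K, B k, F x ∂μ := by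
    rw [integral_biUnion_finset (Finset.range K) (fun k _ => hB k) (fun k _ l _ hkl => hdisj hkl) (fun k _ => hFi.integrableOn)]
  rw [hU]
  exact setIntegral_le_integral hFi (Filter.Eventually.of_forall fun x => hF0 x)

end Summit.QuantumFields.YangMills.Theorems.FemtoTransferGap.Translate

end
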